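import Summits.QuantumFields.YangMills.Theorems.BalabanUVNodesSpineReadingOfRecord13CoPHKComponentSizeBlocksFreshTowerT

/-!
# THE N20 ONE-STEP FRESH LETTERS FROM PER-HISTORY (CONDITIONAL) ONE-STEP LETTERS: the class-level hypothesis (O) of the tower faces follows, fibre by fibre over the
# prefix map `Seq.init`, from a letter stated GIVEN THE HISTORY — «for every level-`m` sequence `π₀` in which the level-`(m+1)` cubes are still small, the (2.18)-mass of its
# one-step extensions in which they all turn large is at most `ζ^{#cubes}` times the mass of `π₀`» — the shape of [LF-II]'s fundamental inequality (1.89)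
# (`T_k(X) 1 ≤ exp(−2(1+β₀)⁻¹ p₀(g_k))`: the 𝐓-operation restricted to a newly created large-field region, conditional on everything before)

Cell `pub-ymgap`, YM-PLAN Track A (HUMAN RULING D-0062; width push D-0149); seat `pub-ymgap-dag-n20-d` (R134 (a) N20 NE7b s3 = the U5d ∕ `crOfRecord₁₃` lineage, its declarer)
gen 37.  `--kind proof --supports stmt-QuantumFields-27366 --as helper` (K3⁸); COUNT-NEUTRAL; THEOREMS ONLY (0 `def`).  Imports the sibling `…BlocksFreshTowerT` ((T) at the
live-pinned record; the faces).  [III] = [Balaban1988Convergent]; [LF-II] = [Balaban1989LargeFieldII].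

WHAT.  §1 (generic, finite sums): ★ `sum_filter_le_mul_sum_filter_of_fibreLetters` — over a prefix map `init : S₁ → S₀` with class-wise telescoping weights (`Σ_{init s = π} c₁ s
= c₀ π`, `c₀ ≥ 0`), a PER-FIBRE letter «`P π ⇒ Σ_{init s = π ∧ Q s} c₁ s ≤ z·c₀ π`» gives the CLASS letter `Σ_{P (init s) ∧ Q s} c₁ s ≤ z · Σ_{P′ (init s)} c₁ s` for any `P ⇒ P′`.
§2 ★★ `oneStepFreshLetters_A_of_fibre`: run A's hypothesis hOA of `…BlocksFreshTowerFaces ∕ …BlocksFreshTowerT` at one `(K, t, j, B, a, i)` FROM the per-history letters hFA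
(below), the telescoping law (T) below `K₀ + K` and `0 ≤` the class weights — the level-`i` event «cubes of level `≤ i` fresh» splits into «cubes of level `< i` fresh, and the
level-`i` cubes inside `Λ_{i−1}`» READ ON THE PREFIX (`Seq.init_Λ`) and «the level-`i` cubes outside `Λ_i`» read on the new entry.  §3 ★★ `oneStepFreshLetters_B_of_fibre`: the
same for run B (length `i+1` at level `i`, events read one level up through `truncShift_Λ = blockDownSet ∘ Λ_{·+1}`).
THE PER-HISTORY LETTER (run A; run B alike one level up): for every `m` with `m + 1 ≤ j` and every level-`m` sequence `π₀` with `c_b ⊆ Λ_m(π₀)` for the cubes `b` of level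
`i_b = m+1` (when `m ≥ 1`):  `Σ_{π : π.init = π₀ ∧ ∀ b (i_b = m+1), c_b ⊆ (Λ_{m+1}(π))ᶜ} cw_{m+1}(π) ≤ (Π_{b : i_b = m+1} ζ K j i_b) · cw_m(π₀)`.

HONEST FRAMING.  [bookkeeping] finite sums BY NAME; the per-history letters are HYPOTHESES inhabited for no family today — [LF-II] (1.89) p. 387's KIND, whose printed proof uses
the inductive representation (2.21) [III] of the level-`m` densities (Theorem 1 [III]); NOT PRINTED as a statement about the (2.18) class weights; NO weight is bounded, NO estimate
proved; nothing of Bałaban's asserted; NE7 ∕ NE7b ∕ NE7c NOT PRINTED for `d = 4` ∕ NOT proved; no `Provisos₁₃CoPH` inhabitant claimed (K0⁷ OPEN); N20 NOT discharged; counts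
UNMOVED (typed 28∕28 · discharged 8∕27); one finite four-torus programme at fixed `ε` — NOT ℝ⁴, NOT OS, NOT a mass gap, NOT the Clay problem.  No `def`, no `instance`, no
`notation`, no `sorry`; no decl below carries a cite tag.
-/

noncomputable section

open MeasureTheory
open scoped BigOperators
open Finset

namespace YMDAG.UVSplit

open Literature.MathematicalPhysics.QuantumFieldTheory.Balaban1983to89
open Literature.MathematicalPhysics.QuantumFieldTheory.Balaban1983to89.T4Continuum
open Literature.MathematicalPhysics.QuantumFieldTheory.Balaban1983to89.Node00
open Literature.MathematicalPhysics.QuantumFieldTheory.Balaban1983to89.B14.Eq218Concrete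
open Literature.MathematicalPhysics.QuantumFieldTheory.Balaban1983to89.B5Eq118OneStroke (iterBlockOf iterBlock)

/-! ## §1 Generic: a per-fibre letter over a prefix map gives the class letter -/

section Generic

/-- ★ **A PER-FIBRE LETTER GIVES THE CLASS LETTER.**  `init : S₁ → S₀` a prefix map, weights `c₁` on `S₁` telescoping class-wise onto `c₀ ≥ 0` on `S₀` (over the fibres
`T π = {s ∣ init s = π}`); predicates `P ⇒ P′` on prefixes and `Q` on extensions; a rate `z ≥ 0`.  IF for every prefix `π` with `P π` the class `Fb π = {s ∣ init s = π ∧ Q s}`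
weighs at most `z · c₀ π`, THEN the class `R = «P (init s) ∧ Q s»` weighs at most `z` times the class `R′ = «P′ (init s)»` (group both by the fibres of `init`;
`Finset.sum_fiberwise_of_maps_to`).  The classes are given by membership laws, so no decidability instance is fixed here. [bookkeeping] -/
theorem sum_filter_le_mul_sum_filter_of_fibreLetters {S₀ S₁ : Type*} [Fintype S₀] [Fintype S₁] (init : S₁ → S₀)
    (c₀ : S₀ → ℝ) (c₁ : S₁ → ℝ) (hc₀ : ∀ π, 0 ≤ c₀ π)
    (T : S₀ → Finset S₁) (hTm : ∀ π s, s ∈ T π ↔ init s = π) (hT : ∀ π, ∑ s ∈ T π, c₁ s = c₀ π)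
    (P P' : S₀ → Prop) (Q : S₁ → Prop) (hPP' : ∀ π, P π → P' π) {z : ℝ} (hz : 0 ≤ z)
    (Fb : S₀ → Finset S₁) (hFb : ∀ π s, s ∈ Fb π ↔ init s = π ∧ Q s) (hF : ∀ π, P π → ∑ s ∈ Fb π, c₁ s ≤ z * c₀ π)
    (R : S₁ → Prop) [DecidablePred R] (hR : ∀ s, R s ↔ P (init s) ∧ Q s)
    (R' : S₁ → Prop) [DecidablePred R'] (hR' : ∀ s, R' s ↔ P' (init s)) :
    ∑ s ∈ Finset.univ.filter R, c₁ s ≤ z * ∑ s ∈ Finset.univ.filter R', c₁ s := by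
  classical
  -- group both classes by the fibres of `init`
  have hL : ∑ s ∈ Finset.univ.filter R, c₁ s = ∑ π ∈ Finset.univ.filter P, ∑ s ∈ Fb π, c₁ s := by
    rw [← Finset.sum_fiberwise_of_maps_to (s := Finset.univ.filter R) (t := Finset.univ.filter P) (g := init)
      (fun s hs => Finset.mem_filter.2 ⟨Finset.mem_univ _, ((hR s).1 (Finset.mem_filter.1 hs).2).1⟩) c₁]
    refine Finset.sum_congr rfl fun π hπ => Finset.sum_congr ?_ fun _ _ => rfl
    have hPπ : P π := (Finset.mem_filter.1 hπ).2
    ext s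
    rw [hFb π s]
    simp only [Finset.mem_filter, Finset.mem_univ, true_and, hR s]
    constructor
    · rintro ⟨⟨-, hQ⟩, h⟩
      exact ⟨h, hQ⟩
    · rintro ⟨h, hQ⟩
      refine ⟨⟨?_, hQ⟩, h⟩
      rw [h]
      exact hPπ
  have hRR : ∑ s ∈ Finset.univ.filter R', c₁ s = ∑ π ∈ Finset.univ.filter P', c₀ π := by
    rw [← Finset.sum_fiberwise_of_maps_to (s := Finset.univ.filter R') (t := Finset.univ.filter P') (g := init)
      (fun s hs => Finset.mem_filter.2 ⟨Finset.mem_univ _, (hR' s).1 (Finset.mem_filter.1 hs).2⟩) c₁]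
    refine Finset.sum_congr rfl fun π hπ => ?_
    have hPπ : P' π := (Finset.mem_filter.1 hπ).2
    rw [← hT π]
    refine Finset.sum_congr ?_ fun _ _ => rfl
    ext s
    rw [hTm π s]
    simp only [Finset.mem_filter, Finset.mem_univ, true_and, hR' s]
    constructor
    · rintro ⟨-, h⟩
      exact h
    · intro h
      refine ⟨?_, h⟩
      rw [h]
      exact hPπ
  rw [hL, hRR, Finset.mul_sum]
  calc ∑ π ∈ Finset.univ.filter P, ∑ s ∈ Fb π, c₁ s
      ≤ ∑ π ∈ Finset.univ.filter P, z * c₀ π := Finset.sum_le_sum fun π hπ => hF π (Finset.mem_filter.1 hπ).2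
    _ ≤ ∑ π ∈ Finset.univ.filter P', z * c₀ π :=
        Finset.sum_le_sum_of_subset_of_nonneg
          (fun π hπ => Finset.mem_filter.2 ⟨Finset.mem_univ _, hPP' π (Finset.mem_filter.1 hπ).2⟩)
          (fun π _ _ => mul_nonneg hz (hc₀ π))

end Generic

/-! ## §2 Run A: the class-level one-step fresh letters hOA from per-history letters -/

section Runs

variable {F : T4Family} {N : ℕ} [NeZero N]
variable (θ : Stage13HParams F N) (hP : θ.Provisos₁₃CoPH F N) (K₀ : ℕ) (g₀ : ℕ → ℝ) (os : List (ULoop F)) (lv : ℕ → ℕ → ℕ)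

open scoped Classical in
/-- ★★ **RUN A — hOA FROM PER-HISTORY ONE-STEP LETTERS.**  Fix `K, t`, a level `j ≤ K₀ + K`, a block family `B` at level `lv K j` with an assignment `a : b ↦ (i_b, c_b)`,
`i_b ∈ [1, j]`, rates `ζ K j · ≥ 0`.  IF run A's (2.18) class weights are `≥ 0` and telescope class-wise below `K₀ + K` ((T), a theorem at the live-pinned record:
`…BlocksFreshTowerT.classWeightOfDatum₉_telescoping_A_of_ppSelLive`), and (F_A) for every `m` with `m + 1 ≤ j` and every level-`m` sequence `π₀` whose cubes of level
`i_b = m+1` lie in `Λ_{i_b − 1}(π₀)` (when `i_b ≥ 2`), the extensions `π` of `π₀` with every such cube outside `Λ_{i_b}(π)` weigh at most `(Π_{b : i_b = m+1} ζ K j i_b) · cw_m(π₀)`,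
THEN at every level `i ∈ [1, j]` the level-`i` class «every cube of level `≤ i` fresh» weighs at most `(Π_{b : i_b = i} ζ K j i_b)` × the level-`i` class «every cube of level
`< i` fresh» — hypothesis hOA of the faces at `(K, t, j, B, a, i)` (§1 at `Seq.init`; the lower cubes and the `Λ_{i−1}`-clause are decided by the prefix, `Seq.init_Λ`). [bookkeeping] -/
theorem oneStepFreshLetters_A_of_fibre (K : ℕ) (t : ℝ) {j : ℕ} (hjK : j ≤ K₀ + K) (B : Finset (Site (F.P (K₀ + K)) (lv K j)))
    {a : (b : Site (F.P (K₀ + K)) (lv K j)) → b ∈ B → (Σ i : ℕ, Site (F.P (K₀ + K)) (lv K i))}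
    (ha : ∀ b (hb : b ∈ B), (a b hb).1 ∈ Finset.Icc 1 j) {ζ : ℕ → ℕ → ℕ → ℝ} (hζ0 : ∀ i, 0 ≤ ζ K j i)
    (hcw0 : ∀ m (π : SeqOfRecord F θ.ν θ.τ9.M (histA₁₃ θ K₀ g₀ K) (K₀ + K) m),
      0 ≤ classWeightOfDatum₉ F N θ.toStage9Params (datumOfRecord₁₃CoPH F N θ hP) g₀ os (runA₁₃ F K₀ g₀ K) (histA₁₃ θ K₀ g₀ K) m t π)
    (hT : ∀ m, m < K₀ + K → ∀ π : SeqOfRecord F θ.ν θ.τ9.M (histA₁₃ θ K₀ g₀ K) (K₀ + K) m,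
      ∑ s' ∈ Finset.univ.filter (fun s' : SeqOfRecord F θ.ν θ.τ9.M (histA₁₃ θ K₀ g₀ K) (K₀ + K) (m + 1) => s'.init = π),
        classWeightOfDatum₉ F N θ.toStage9Params (datumOfRecord₁₃CoPH F N θ hP) g₀ os (runA₁₃ F K₀ g₀ K) (histA₁₃ θ K₀ g₀ K) (m + 1) t s' =
      classWeightOfDatum₉ F N θ.toStage9Params (datumOfRecord₁₃CoPH F N θ hP) g₀ os (runA₁₃ F K₀ g₀ K) (histA₁₃ θ K₀ g₀ K) m t π)
    (hF : ∀ m, m + 1 ≤ j → ∀ π₀ : SeqOfRecord F θ.ν θ.τ9.M (histA₁₃ θ K₀ g₀ K) (K₀ + K) m,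
      (∀ x ∈ B.attach, (a x.1 x.2).1 = m + 1 → 2 ≤ (a x.1 x.2).1 →
        (↑(iterBlock (lv K (a x.1 x.2).1) (a x.1 x.2).2) : Set (Site (F.P (K₀ + K)) 0)) ⊆ π₀.Λ ((a x.1 x.2).1 - 1)) →
      ∑ π ∈ Finset.univ.filter (fun π : SeqOfRecord F θ.ν θ.τ9.M (histA₁₃ θ K₀ g₀ K) (K₀ + K) (m + 1) =>
          π.init = π₀ ∧ ∀ x ∈ B.attach, (a x.1 x.2).1 = m + 1 →
            (↑(iterBlock (lv K (a x.1 x.2).1) (a x.1 x.2).2) : Set (Site (F.P (K₀ + K)) 0)) ⊆ (π.Λ (a x.1 x.2).1)ᶜ),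
        classWeightOfDatum₉ F N θ.toStage9Params (datumOfRecord₁₃CoPH F N θ hP) g₀ os (runA₁₃ F K₀ g₀ K) (histA₁₃ θ K₀ g₀ K) (m + 1) t π ≤
      (∏ x ∈ B.attach.filter (fun x => (a x.1 x.2).1 = m + 1), ζ K j (a x.1 x.2).1) *
        classWeightOfDatum₉ F N θ.toStage9Params (datumOfRecord₁₃CoPH F N θ hP) g₀ os (runA₁₃ F K₀ g₀ K) (histA₁₃ θ K₀ g₀ K) m t π₀)
    (i : ℕ) (hi : i ∈ Finset.Icc 1 j) :
    ∑ π ∈ Finset.univ.filter (fun π : SeqOfRecord F θ.ν θ.τ9.M (histA₁₃ θ K₀ g₀ K) (K₀ + K) i =>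
        ∀ x ∈ B.attach, (a x.1 x.2).1 ≤ i →
          (↑(iterBlock (lv K (a x.1 x.2).1) (a x.1 x.2).2) : Set (Site (F.P (K₀ + K)) 0)) ⊆ (π.Λ (a x.1 x.2).1)ᶜ ∧
          (2 ≤ (a x.1 x.2).1 → (↑(iterBlock (lv K (a x.1 x.2).1) (a x.1 x.2).2) : Set (Site (F.P (K₀ + K)) 0)) ⊆ π.Λ ((a x.1 x.2).1 - 1))),
      classWeightOfDatum₉ F N θ.toStage9Params (datumOfRecord₁₃CoPH F N θ hP) g₀ os (runA₁₃ F K₀ g₀ K) (histA₁₃ θ K₀ g₀ K) i t π ≤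
    (∏ x ∈ B.attach.filter (fun x => (a x.1 x.2).1 = i), ζ K j (a x.1 x.2).1) *
      ∑ π ∈ Finset.univ.filter (fun π : SeqOfRecord F θ.ν θ.τ9.M (histA₁₃ θ K₀ g₀ K) (K₀ + K) i =>
          ∀ x ∈ B.attach, (a x.1 x.2).1 < i →
            (↑(iterBlock (lv K (a x.1 x.2).1) (a x.1 x.2).2) : Set (Site (F.P (K₀ + K)) 0)) ⊆ (π.Λ (a x.1 x.2).1)ᶜ ∧
            (2 ≤ (a x.1 x.2).1 → (↑(iterBlock (lv K (a x.1 x.2).1) (a x.1 x.2).2) : Set (Site (F.P (K₀ + K)) 0)) ⊆ π.Λ ((a x.1 x.2).1 - 1))),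
        classWeightOfDatum₉ F N θ.toStage9Params (datumOfRecord₁₃CoPH F N θ hP) g₀ os (runA₁₃ F K₀ g₀ K) (histA₁₃ θ K₀ g₀ K) i t π := by
  obtain ⟨hi1, hij⟩ := Finset.mem_Icc.1 hi
  obtain ⟨m, rfl⟩ : ∃ m, i = m + 1 := ⟨i - 1, by omega⟩
  have ha1 : ∀ x ∈ B.attach, 1 ≤ (a x.1 x.2).1 ∧ (a x.1 x.2).1 ≤ j := fun x _ => Finset.mem_Icc.1 (ha x.1 x.2)
  -- the pins' fresh predicate on a run-A sequence of any length
  let fr : (n : ℕ) → SeqOfRecord F θ.ν θ.τ9.M (histA₁₃ θ K₀ g₀ K) (K₀ + K) n → {x // x ∈ B} → Prop := fun n s x =>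
    (↑(iterBlock (lv K (a x.1 x.2).1) (a x.1 x.2).2) : Set (Site (F.P (K₀ + K)) 0)) ⊆ (s.Λ (a x.1 x.2).1)ᶜ ∧
      (2 ≤ (a x.1 x.2).1 → (↑(iterBlock (lv K (a x.1 x.2).1) (a x.1 x.2).2) : Set (Site (F.P (K₀ + K)) 0)) ⊆ s.Λ ((a x.1 x.2).1 - 1))
  -- a pin of level `≤ m` is decided by the prefix
  have hev : ∀ (π : SeqOfRecord F θ.ν θ.τ9.M (histA₁₃ θ K₀ g₀ K) (K₀ + K) (m + 1)), ∀ x ∈ B.attach, (a x.1 x.2).1 ≤ m →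
      (fr (m + 1) π x ↔ fr m π.init x) := by
    intro π x hx hxm
    have h1 := (ha1 x hx).1
    simp only [fr]
    rw [Seq.init_Λ π h1 hxm]
    by_cases h2 : 2 ≤ (a x.1 x.2).1
    · rw [Seq.init_Λ π (by omega) (by omega)]
    · simp only [h2, false_implies]
  -- a pin of level `m + 1`: its `Λ_{m}`-clause is decided by the prefix
  have htop : ∀ (π : SeqOfRecord F θ.ν θ.τ9.M (histA₁₃ θ K₀ g₀ K) (K₀ + K) (m + 1)), ∀ x ∈ B.attach, (a x.1 x.2).1 = m + 1 →
      (fr (m + 1) π x ↔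
        ((↑(iterBlock (lv K (a x.1 x.2).1) (a x.1 x.2).2) : Set (Site (F.P (K₀ + K)) 0)) ⊆ (π.Λ (a x.1 x.2).1)ᶜ ∧
          (2 ≤ (a x.1 x.2).1 → (↑(iterBlock (lv K (a x.1 x.2).1) (a x.1 x.2).2) : Set (Site (F.P (K₀ + K)) 0)) ⊆ π.init.Λ ((a x.1 x.2).1 - 1)))) := by
    intro π x _ hxm
    simp only [fr]
    by_cases h2 : 2 ≤ (a x.1 x.2).1
    · rw [Seq.init_Λ π (by omega) (by omega)]
    · simp only [h2, false_implies]
  refine sum_filter_le_mul_sum_filter_of_fibreLetters Seq.init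
    (fun π₀ => classWeightOfDatum₉ F N θ.toStage9Params (datumOfRecord₁₃CoPH F N θ hP) g₀ os (runA₁₃ F K₀ g₀ K) (histA₁₃ θ K₀ g₀ K) m t π₀)
    (fun π => classWeightOfDatum₉ F N θ.toStage9Params (datumOfRecord₁₃CoPH F N θ hP) g₀ os (runA₁₃ F K₀ g₀ K) (histA₁₃ θ K₀ g₀ K) (m + 1) t π)
    (hcw0 m) (fun π₀ => Finset.univ.filter (fun s' : SeqOfRecord F θ.ν θ.τ9.M (histA₁₃ θ K₀ g₀ K) (K₀ + K) (m + 1) => s'.init = π₀))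
    (fun π₀ s => by rw [Finset.mem_filter]; exact ⟨fun h => h.2, fun h => ⟨Finset.mem_univ _, h⟩⟩) (hT m (by omega))
    (fun π₀ => (∀ x ∈ B.attach, (a x.1 x.2).1 ≤ m → fr m π₀ x) ∧
      (∀ x ∈ B.attach, (a x.1 x.2).1 = m + 1 → 2 ≤ (a x.1 x.2).1 →
        (↑(iterBlock (lv K (a x.1 x.2).1) (a x.1 x.2).2) : Set (Site (F.P (K₀ + K)) 0)) ⊆ π₀.Λ ((a x.1 x.2).1 - 1)))
    (fun π₀ => ∀ x ∈ B.attach, (a x.1 x.2).1 ≤ m → fr m π₀ x)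
    (fun π => ∀ x ∈ B.attach, (a x.1 x.2).1 = m + 1 →
      (↑(iterBlock (lv K (a x.1 x.2).1) (a x.1 x.2).2) : Set (Site (F.P (K₀ + K)) 0)) ⊆ (π.Λ (a x.1 x.2).1)ᶜ)
    (fun π₀ h => h.1) (Finset.prod_nonneg fun x _ => hζ0 _)
    (fun π₀ => Finset.univ.filter (fun π : SeqOfRecord F θ.ν θ.τ9.M (histA₁₃ θ K₀ g₀ K) (K₀ + K) (m + 1) =>
      π.init = π₀ ∧ ∀ x ∈ B.attach, (a x.1 x.2).1 = m + 1 →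
        (↑(iterBlock (lv K (a x.1 x.2).1) (a x.1 x.2).2) : Set (Site (F.P (K₀ + K)) 0)) ⊆ (π.Λ (a x.1 x.2).1)ᶜ))
    (fun π₀ s => by rw [Finset.mem_filter]; exact ⟨fun h => h.2, fun h => ⟨Finset.mem_univ _, h⟩⟩) (fun π₀ h => hF m hij π₀ h.2)
    _ (fun π => ⟨fun H => ⟨⟨fun x hx hxm => (hev π x hx hxm).1 (H x hx (by omega)), fun x hx hxm =>
      ((htop π x hx hxm).1 (H x hx hxm.le)).2⟩, fun x hx hxm => ((htop π x hx hxm).1 (H x hx hxm.le)).1⟩, fun H x hx hxm => ?_⟩)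
    _ (fun π => forall₂_congr fun x hx =>
      ⟨fun H hxm => (hev π x hx hxm).1 (H (Nat.lt_succ_iff.2 hxm)), fun H hxm => (hev π x hx (Nat.lt_succ_iff.1 hxm)).2 (H (Nat.lt_succ_iff.1 hxm))⟩)
  rcases Nat.lt_or_eq_of_le hxm with hlt | heq
  · exact (hev π x hx (Nat.lt_succ_iff.1 hlt)).2 (H.1.1 x hx (Nat.lt_succ_iff.1 hlt))
  · exact (htop π x hx heq).2 ⟨H.2 x hx heq, H.1.2 x hx heq⟩

/-! ## §3 Run B: the same one level up, through the flow-free truncation -/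

open scoped Classical in
/-- ★★ **RUN B — hOB FROM PER-HISTORY ONE-STEP LETTERS** (run B's index at cutoff `K₀ + K + 1`, the fresh events read through the flow-free truncation `truncShift` of the
LENGTH-`(i+1)` sequence at level `i`: `truncShift_Λ`, `Λ′_ℓ = blockDownSet Λ_{ℓ+1}`).  (F_B): for every `n ∈ [1, j]` and every length-`n` sequence `π₀` of run B whose cubes of
level `i_b = n` lie in `blockDownSet (Λ_{i_b}(π₀))` (when `i_b ≥ 2`; read as `Λ′_{i_b − 1}`), the extensions `π` of `π₀` with every such cube outside `blockDownSet (Λ_{i_b + 1}(π))`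
(= outside `Λ′_{i_b}`) weigh at most `(Π_{b : i_b = n} ζ K j i_b) · cw^B_n(π₀)`.  With (T) below `K₀ + K + 1` and `0 ≤ cw^B` this gives hOB at `(K, t, j, B, a, i)`. [bookkeeping] -/
theorem oneStepFreshLetters_B_of_fibre (hM : 0 < θ.τ9.M) (K : ℕ) (t : ℝ) {j : ℕ} (hjK : j ≤ K₀ + K) (B : Finset (Site (F.P (K₀ + K)) (lv K j)))
    {a : (b : Site (F.P (K₀ + K)) (lv K j)) → b ∈ B → (Σ i : ℕ, Site (F.P (K₀ + K)) (lv K i))}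
    (ha : ∀ b (hb : b ∈ B), (a b hb).1 ∈ Finset.Icc 1 j) {ζ : ℕ → ℕ → ℕ → ℝ} (hζ0 : ∀ i, 0 ≤ ζ K j i)
    (hcw0 : ∀ m (π : SeqOfRecord F θ.ν θ.τ9.M (histB₁₃ θ K₀ g₀ K) (K₀ + K + 1) m),
      0 ≤ classWeightOfDatum₉ F N θ.toStage9Params (datumOfRecord₁₃CoPH F N θ hP) g₀ os (runB₁₃ F K₀ g₀ K) (histB₁₃ θ K₀ g₀ K) m t π)
    (hT : ∀ m, m < K₀ + K + 1 → ∀ π : SeqOfRecord F θ.ν θ.τ9.M (histB₁₃ θ K₀ g₀ K) (K₀ + K + 1) m,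
      ∑ s' ∈ Finset.univ.filter (fun s' : SeqOfRecord F θ.ν θ.τ9.M (histB₁₃ θ K₀ g₀ K) (K₀ + K + 1) (m + 1) => s'.init = π),
        classWeightOfDatum₉ F N θ.toStage9Params (datumOfRecord₁₃CoPH F N θ hP) g₀ os (runB₁₃ F K₀ g₀ K) (histB₁₃ θ K₀ g₀ K) (m + 1) t s' =
      classWeightOfDatum₉ F N θ.toStage9Params (datumOfRecord₁₃CoPH F N θ hP) g₀ os (runB₁₃ F K₀ g₀ K) (histB₁₃ θ K₀ g₀ K) m t π)
    (hF : ∀ n ∈ Finset.Icc 1 j, ∀ π₀ : SeqOfRecord F θ.ν θ.τ9.M (histB₁₃ θ K₀ g₀ K) (K₀ + K + 1) n,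
      (∀ x ∈ B.attach, (a x.1 x.2).1 = n → 2 ≤ (a x.1 x.2).1 →
        (↑(iterBlock (lv K (a x.1 x.2).1) (a x.1 x.2).2) : Set (Site (F.P (K₀ + K)) 0)) ⊆ blockDownSet F (K₀ + K) (π₀.Λ ((a x.1 x.2).1 - 1 + 1))) →
      ∑ π ∈ Finset.univ.filter (fun π : SeqOfRecord F θ.ν θ.τ9.M (histB₁₃ θ K₀ g₀ K) (K₀ + K + 1) (n + 1) =>
          π.init = π₀ ∧ ∀ x ∈ B.attach, (a x.1 x.2).1 = n →
            (↑(iterBlock (lv K (a x.1 x.2).1) (a x.1 x.2).2) : Set (Site (F.P (K₀ + K)) 0)) ⊆ (blockDownSet F (K₀ + K) (π.Λ ((a x.1 x.2).1 + 1)))ᶜ),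
        classWeightOfDatum₉ F N θ.toStage9Params (datumOfRecord₁₃CoPH F N θ hP) g₀ os (runB₁₃ F K₀ g₀ K) (histB₁₃ θ K₀ g₀ K) (n + 1) t π ≤
      (∏ x ∈ B.attach.filter (fun x => (a x.1 x.2).1 = n), ζ K j (a x.1 x.2).1) *
        classWeightOfDatum₉ F N θ.toStage9Params (datumOfRecord₁₃CoPH F N θ hP) g₀ os (runB₁₃ F K₀ g₀ K) (histB₁₃ θ K₀ g₀ K) n t π₀)
    (i : ℕ) (hi : i ∈ Finset.Icc 1 j) :
    ∑ π ∈ Finset.univ.filter (fun π : SeqOfRecord F θ.ν θ.τ9.M (histB₁₃ θ K₀ g₀ K) (K₀ + K + 1) (i + 1) =>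
        ∀ x ∈ B.attach, (a x.1 x.2).1 ≤ i →
          (↑(iterBlock (lv K (a x.1 x.2).1) (a x.1 x.2).2) : Set (Site (F.P (K₀ + K)) 0)) ⊆
              ((truncShift F θ.ν hM (histB₁₃ θ K₀ g₀ K) π).Λ (a x.1 x.2).1)ᶜ ∧
          (2 ≤ (a x.1 x.2).1 → (↑(iterBlock (lv K (a x.1 x.2).1) (a x.1 x.2).2) : Set (Site (F.P (K₀ + K)) 0)) ⊆
              (truncShift F θ.ν hM (histB₁₃ θ K₀ g₀ K) π).Λ ((a x.1 x.2).1 - 1))),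
      classWeightOfDatum₉ F N θ.toStage9Params (datumOfRecord₁₃CoPH F N θ hP) g₀ os (runB₁₃ F K₀ g₀ K) (histB₁₃ θ K₀ g₀ K) (i + 1) t π ≤
    (∏ x ∈ B.attach.filter (fun x => (a x.1 x.2).1 = i), ζ K j (a x.1 x.2).1) *
      ∑ π ∈ Finset.univ.filter (fun π : SeqOfRecord F θ.ν θ.τ9.M (histB₁₃ θ K₀ g₀ K) (K₀ + K + 1) (i + 1) =>
          ∀ x ∈ B.attach, (a x.1 x.2).1 < i →
            (↑(iterBlock (lv K (a x.1 x.2).1) (a x.1 x.2).2) : Set (Site (F.P (K₀ + K)) 0)) ⊆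
                ((truncShift F θ.ν hM (histB₁₃ θ K₀ g₀ K) π).Λ (a x.1 x.2).1)ᶜ ∧
            (2 ≤ (a x.1 x.2).1 → (↑(iterBlock (lv K (a x.1 x.2).1) (a x.1 x.2).2) : Set (Site (F.P (K₀ + K)) 0)) ⊆
                (truncShift F θ.ν hM (histB₁₃ θ K₀ g₀ K) π).Λ ((a x.1 x.2).1 - 1))),
        classWeightOfDatum₉ F N θ.toStage9Params (datumOfRecord₁₃CoPH F N θ hP) g₀ os (runB₁₃ F K₀ g₀ K) (histB₁₃ θ K₀ g₀ K) (i + 1) t π := by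
  obtain ⟨hi1, hij⟩ := Finset.mem_Icc.1 hi
  have ha1 : ∀ x ∈ B.attach, 1 ≤ (a x.1 x.2).1 ∧ (a x.1 x.2).1 ≤ j := fun x _ => Finset.mem_Icc.1 (ha x.1 x.2)
  -- the pins' fresh predicate on a run-B sequence of any length `n`, one level up through `blockDownSet` (`truncShift_Λ` when `n = n′ + 1`)
  let fr : (n : ℕ) → SeqOfRecord F θ.ν θ.τ9.M (histB₁₃ θ K₀ g₀ K) (K₀ + K + 1) n → {x // x ∈ B} → Prop := fun n s x =>
    (↑(iterBlock (lv K (a x.1 x.2).1) (a x.1 x.2).2) : Set (Site (F.P (K₀ + K)) 0)) ⊆ (blockDownSet F (K₀ + K) (s.Λ ((a x.1 x.2).1 + 1)))ᶜ ∧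
      (2 ≤ (a x.1 x.2).1 → (↑(iterBlock (lv K (a x.1 x.2).1) (a x.1 x.2).2) : Set (Site (F.P (K₀ + K)) 0)) ⊆
        blockDownSet F (K₀ + K) (s.Λ ((a x.1 x.2).1 - 1 + 1)))
  -- reading the truncation of a sequence of length `i + 1` at a pin of level `≤ i`
  have htr : ∀ (π : SeqOfRecord F θ.ν θ.τ9.M (histB₁₃ θ K₀ g₀ K) (K₀ + K + 1) (i + 1)), ∀ x ∈ B.attach, (a x.1 x.2).1 ≤ i →
      (((↑(iterBlock (lv K (a x.1 x.2).1) (a x.1 x.2).2) : Set (Site (F.P (K₀ + K)) 0)) ⊆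
            ((truncShift F θ.ν hM (histB₁₃ θ K₀ g₀ K) π).Λ (a x.1 x.2).1)ᶜ ∧
          (2 ≤ (a x.1 x.2).1 → (↑(iterBlock (lv K (a x.1 x.2).1) (a x.1 x.2).2) : Set (Site (F.P (K₀ + K)) 0)) ⊆
            (truncShift F θ.ν hM (histB₁₃ θ K₀ g₀ K) π).Λ ((a x.1 x.2).1 - 1))) ↔ fr (i + 1) π x) := by
    intro π x hx hxi
    have h1 := (ha1 x hx).1
    simp only [fr]
    rw [truncShift_Λ F θ.ν hM (histB₁₃ θ K₀ g₀ K) π h1 hxi]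
    by_cases h2 : 2 ≤ (a x.1 x.2).1
    · rw [truncShift_Λ F θ.ν hM (histB₁₃ θ K₀ g₀ K) π (by omega) (by omega)]
    · simp only [h2, false_implies]
  -- a pin of level `< i` is decided by the prefix
  have hev : ∀ (π : SeqOfRecord F θ.ν θ.τ9.M (histB₁₃ θ K₀ g₀ K) (K₀ + K + 1) (i + 1)), ∀ x ∈ B.attach, (a x.1 x.2).1 < i →
      (fr (i + 1) π x ↔ fr i π.init x) := by
    intro π x hx hxi
    have h1 := (ha1 x hx).1
    simp only [fr]
    rw [Seq.init_Λ π (by omega) (by omega)]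
    by_cases h2 : 2 ≤ (a x.1 x.2).1
    · rw [Seq.init_Λ π (by omega) (by omega)]
    · simp only [h2, false_implies]
  -- a pin of level `i`: its lower clause is decided by the prefix
  have htop : ∀ (π : SeqOfRecord F θ.ν θ.τ9.M (histB₁₃ θ K₀ g₀ K) (K₀ + K + 1) (i + 1)), ∀ x ∈ B.attach, (a x.1 x.2).1 = i →
      (fr (i + 1) π x ↔
        ((↑(iterBlock (lv K (a x.1 x.2).1) (a x.1 x.2).2) : Set (Site (F.P (K₀ + K)) 0)) ⊆ (blockDownSet F (K₀ + K) (π.Λ ((a x.1 x.2).1 + 1)))ᶜ ∧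
          (2 ≤ (a x.1 x.2).1 → (↑(iterBlock (lv K (a x.1 x.2).1) (a x.1 x.2).2) : Set (Site (F.P (K₀ + K)) 0)) ⊆
            blockDownSet F (K₀ + K) (π.init.Λ ((a x.1 x.2).1 - 1 + 1))))) := by
    intro π x _ hxi
    simp only [fr]
    by_cases h2 : 2 ≤ (a x.1 x.2).1
    · rw [Seq.init_Λ π (by omega) (by omega)]
    · simp only [h2, false_implies]
  refine sum_filter_le_mul_sum_filter_of_fibreLetters Seq.init
    (fun π₀ => classWeightOfDatum₉ F N θ.toStage9Params (datumOfRecord₁₃CoPH F N θ hP) g₀ os (runB₁₃ F K₀ g₀ K) (histB₁₃ θ K₀ g₀ K) i t π₀)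
    (fun π => classWeightOfDatum₉ F N θ.toStage9Params (datumOfRecord₁₃CoPH F N θ hP) g₀ os (runB₁₃ F K₀ g₀ K) (histB₁₃ θ K₀ g₀ K) (i + 1) t π)
    (hcw0 i) (fun π₀ => Finset.univ.filter (fun s' : SeqOfRecord F θ.ν θ.τ9.M (histB₁₃ θ K₀ g₀ K) (K₀ + K + 1) (i + 1) => s'.init = π₀))
    (fun π₀ s => by rw [Finset.mem_filter]; exact ⟨fun h => h.2, fun h => ⟨Finset.mem_univ _, h⟩⟩) (hT i (by omega))
    (fun π₀ => (∀ x ∈ B.attach, (a x.1 x.2).1 < i → fr i π₀ x) ∧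
      (∀ x ∈ B.attach, (a x.1 x.2).1 = i → 2 ≤ (a x.1 x.2).1 →
        (↑(iterBlock (lv K (a x.1 x.2).1) (a x.1 x.2).2) : Set (Site (F.P (K₀ + K)) 0)) ⊆ blockDownSet F (K₀ + K) (π₀.Λ ((a x.1 x.2).1 - 1 + 1))))
    (fun π₀ => ∀ x ∈ B.attach, (a x.1 x.2).1 < i → fr i π₀ x)
    (fun π => ∀ x ∈ B.attach, (a x.1 x.2).1 = i →
      (↑(iterBlock (lv K (a x.1 x.2).1) (a x.1 x.2).2) : Set (Site (F.P (K₀ + K)) 0)) ⊆ (blockDownSet F (K₀ + K) (π.Λ ((a x.1 x.2).1 + 1)))ᶜ)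
    (fun π₀ h => h.1) (Finset.prod_nonneg fun x _ => hζ0 _)
    (fun π₀ => Finset.univ.filter (fun π : SeqOfRecord F θ.ν θ.τ9.M (histB₁₃ θ K₀ g₀ K) (K₀ + K + 1) (i + 1) =>
      π.init = π₀ ∧ ∀ x ∈ B.attach, (a x.1 x.2).1 = i →
        (↑(iterBlock (lv K (a x.1 x.2).1) (a x.1 x.2).2) : Set (Site (F.P (K₀ + K)) 0)) ⊆ (blockDownSet F (K₀ + K) (π.Λ ((a x.1 x.2).1 + 1)))ᶜ))
    (fun π₀ s => by rw [Finset.mem_filter]; exact ⟨fun h => h.2, fun h => ⟨Finset.mem_univ _, h⟩⟩) (fun π₀ h => hF i hi π₀ h.2)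
    _ (fun π => ⟨fun H => ⟨⟨fun x hx hxi => (hev π x hx hxi).1 ((htr π x hx hxi.le).1 (H x hx hxi.le)), fun x hx hxi =>
      ((htop π x hx hxi).1 ((htr π x hx hxi.le).1 (H x hx hxi.le))).2⟩, fun x hx hxi =>
      ((htop π x hx hxi).1 ((htr π x hx hxi.le).1 (H x hx hxi.le))).1⟩, fun H x hx hxi => (htr π x hx hxi).2 ?_⟩)
    _ (fun π => forall₂_congr fun x hx =>
      ⟨fun H hxi => (hev π x hx hxi).1 ((htr π x hx hxi.le).1 (H hxi)), fun H hxi => (htr π x hx hxi.le).2 ((hev π x hx hxi).2 (H hxi))⟩)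
  rcases Nat.lt_or_eq_of_le hxi with hlt | heq
  · exact (hev π x hx hlt).2 (H.1.1 x hx hlt)
  · exact (htop π x hx heq).2 ⟨H.2 x hx heq, H.1.2 x hx heq⟩

end Runs

end YMDAG.UVSplit

end
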